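import Summits.Ventures.GridStability.Models.SwingFrequencyBound
import Summits.Ventures.GridStability.Models.DroopFrequencyBand

/-!
# GridStability/Models/AggregateFrequency — EXACT aggregate frequency law of the droop microgrid (FULL model, voltages moving) and of the classical model with uniform damping (COI speed); lossy funnel

Cell `gridfusion` (LADDER-GRIDFUSION, apex line G3.b / rung G3.e; seat gridfusion-model-3 (g8);
models/MODEL-3-NOTES.md §1 (P21)). Companion of `Models/SwingFrequencyBound.lean` (★ #79, a crude per-unit
band) and `Models/DroopFrequencyBand.lean` («#79″», the band for the FULL model): the AGGREGATE frequency
of the model obeys an EXACT scalar law — no certificate, no bound to choose, 0 kit.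

Sources (read on the page). [cite: ShinZavala2020] (arXiv:2002.09802) §III-A before eq. (9): the
synchronised frequency is obtained «by dividing (8b) by `k_Pi` and summing over all the nodes», and
«`Σ_{i∈V} P_i = 0` (a property of the lossless network)» [corpus:paper:arxiv-2002.09802 p.4] — the two steps
below, performed along ARBITRARY solutions; [cite: KunduEtAl2019] (4a)–(4c), (5a)–(5b) = the typed model
`DroopMicrogrid.field` (p464230); [cite: SauerPai1998] §6.10 (6.242)–(6.244) (COI angle/speed
`ω_COI = (1/M_T) Σ M_i ω_i`, `M_T = Σ M_i`; «swing equations with uniform damping (`H_i/D_i = H_k/D_k`)»)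
[galaxy:panama:353827995779076 p0101 L27–L37] and §9.5 (9.19)–(9.20) (`P_i = P_mi − E_i²G_ii`,
`P_COI = Σ_i P_i − 2 Σ_i Σ_{j>i} D_ij cos θ_ij`) [ibid. p0177 L9–L25]; [cite: SimpsonporcoDorflerBullo2013]
Thm. 2 (the limit value = lit-2's `DroopNetwork.avgFrequency`).

WHAT IS CERTIFIED (kernel; std axioms). §1 DROOP MICROGRID, FULL MODEL (4a)–(4c) in bus-admittance form,
`n` units, LOSSLESS reduced network (`G = 0`, `B` symmetric), COMMON active-power filter constant `τ_Pi = τ`,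
nonzero droop gains: with `S(ω) := Σ_i ω_i/λ^p_i`, along EVERY solution on `[0, T]`:
`S(ω(t)) − Σ_i P_i^set = (S(ω(0)) − Σ_i P_i^set) e^{−t/τ}` EXACTLY (`droopSum_sub_eq`); equivalently the
droop-weighted mean frequency `ω̄ = S/Σ_i (1/λ^p_i)` obeys `ω̄(t) − ω_s = (ω̄(0) − ω_s) e^{−t/τ}`, `ω_s =
Σ P_i^set/Σ (1/λ^p_i)` the synchronised frequency of `InverterNetwork.syncFrequency_eq`
(`meanFreq_sub_syncFreq_eq`), and `ω̄ → ω_s` for `τ > 0` (`meanFreq_tendsto_syncFreq`) — angles AND voltages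
arbitrary, synchronised or not. §2 CLASSICAL MODEL `M_cl` [cite: SauerPai1998, (7.215)–(7.216)] with UNIFORM
damping `D_i = d M_i`, symmetric `B`: the COI momentum `p := Σ_i M_i ω_i = M_T ω_COI` has derivative
`P_COI(δ) − d p`, `P_COI(δ) = Σ_i (P_i − P_ei(δ)) = Σ_i P′_i − Σ_{i≠j} D_ij cos δ_ij` (`Pcoi_eq`); hence (a) NO
transfer conductances: `p(t) − Σ P′_i/d = (p(0) − Σ P′_i/d) e^{−dt}` EXACTLY (`coiMomentum_sub_eq_of_lossless`),
`ω_COI → Σ P′_i/(d M_T)` (`coiSpeed_tendsto_of_lossless`); (b) WITH transfer conductances, `Γ := Σ_{i≠j}|D_ij|`,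
`d > 0`: `|p(t) − Σ P′_i/d| ≤ Γ/d + |p(0) − Σ P′_i/d| e^{−dt}` (`abs_coiMomentum_sub_le`). By
`DroopMicrogrid.freqField_eq_field` §2 is also the frozen-voltage droop microgrid with common filter
constant `τ = 1/d`; §1 is stronger there (voltages move) but needs `G = 0` entirely.

THREE COLUMNS. CERTIFIED: the identities/inequalities above. MODELLED: (4a)–(4c) (MV-6N/V0: no limiter, no
inner loops, quasi-static lossless reduced network, common filter constant) / `M_cl` with uniform damping
(MV-2/MV-2L). HONEST FRAMING: AGGREGATE statements only — units may pole-slip or drift apart while the mean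
converges; nothing here is a synchronisation or stability statement; heterogeneous filter constants /
damping ratios: no closed aggregate law claimed. VALIDATED: nothing (the aggregated «system frequency»
models of the engineering literature are the comparators; not juxtaposed here).
-/

noncomputable section

open Real Set Filter Finset Topology

namespace Summit.Ventures.GridStability.Models

/-! ## §0 Two scalar comparison lemmas on `[0, T]` (exponential weight; no sign condition on the rate) -/

namespace AggregateFrequency

/-- One-sided funnel: `φ' ≤ c (K − φ)` within `[0, T]` ⇒ `φ(t) − K ≤ (φ(0) − K) e^{−ct}` (any real `c`). -/
theorem sub_le_mul_exp {φ φ' : ℝ → ℝ} {T c K : ℝ}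
    (hφ : ∀ t ∈ Icc 0 T, HasDerivWithinAt φ (φ' t) (Icc 0 T) t)
    (hle : ∀ t ∈ Icc 0 T, φ' t ≤ c * (K - φ t)) {t : ℝ} (ht : t ∈ Icc 0 T) :
    φ t - K ≤ (φ 0 - K) * exp (-(c * t)) := by
  set g : ℝ → ℝ := fun s => (φ s - K) * exp (c * s) with hg
  have hexpd : ∀ s, HasDerivWithinAt (fun r => exp (c * r)) (exp (c * s) * (c * 1)) (Icc 0 T) s :=
    fun s => ((hasDerivWithinAt_id s _).const_mul c).exp
  have hder : ∀ s ∈ Icc 0 T, HasDerivWithinAt g ((φ' s + c * (φ s - K)) * exp (c * s)) (Icc 0 T) s := by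
    intro s hs
    refine (((hφ s hs).sub_const K).mul (hexpd s)).congr_deriv ?_
    ring
  have hanti : AntitoneOn g (Icc 0 T) := by
    refine antitoneOn_of_hasDerivWithinAt_nonpos (convex_Icc 0 T)
      (f' := fun s => (φ' s + c * (φ s - K)) * exp (c * s))
      (fun s hs => (hder s hs).continuousWithinAt) (fun s hs => ?_) (fun s hs => ?_)
    · exact (hder s (interior_subset hs)).mono interior_subset
    · have hs' : s ∈ Icc 0 T := interior_subset hs
      exact mul_nonpos_of_nonpos_of_nonneg (by linarith [hle s hs']) (exp_pos _).le
  have hg0 := hanti ⟨le_rfl, ht.1.trans ht.2⟩ ht ht.1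
  simp only [hg, mul_zero, exp_zero, mul_one] at hg0
  have hmul := mul_le_mul_of_nonneg_right hg0 (exp_pos (-(c * t))).le
  have he : exp (c * t) * exp (-(c * t)) = 1 := by rw [← exp_add]; simp
  calc φ t - K = (φ t - K) * (exp (c * t) * exp (-(c * t))) := by rw [he, mul_one]
    _ = (φ t - K) * exp (c * t) * exp (-(c * t)) := by ring
    _ ≤ (φ 0 - K) * exp (-(c * t)) := hmul

/-- One-sided funnel, lower side: `c (K − φ) ≤ φ'` within `[0, T]` ⇒ `(φ(0) − K) e^{−ct} ≤ φ(t) − K`. -/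
theorem mul_exp_le_sub {φ φ' : ℝ → ℝ} {T c K : ℝ}
    (hφ : ∀ t ∈ Icc 0 T, HasDerivWithinAt φ (φ' t) (Icc 0 T) t)
    (hge : ∀ t ∈ Icc 0 T, c * (K - φ t) ≤ φ' t) {t : ℝ} (ht : t ∈ Icc 0 T) :
    (φ 0 - K) * exp (-(c * t)) ≤ φ t - K := by
  have h := sub_le_mul_exp (φ := fun s => -φ s) (φ' := fun s => -φ' s) (K := -K) (c := c)
    (fun s hs => (hφ s hs).neg) (fun s hs => by linarith [hge s hs]) ht
  have h1 : -φ t - -K = -(φ t - K) := by ring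
  have h2 : (-φ 0 - -K) * exp (-(c * t)) = -((φ 0 - K) * exp (-(c * t))) := by ring
  simp only [h1, h2] at h
  linarith

/-- Exact exponential law: `φ' = c (K − φ)` within `[0, T]` ⇒ `φ(t) − K = (φ(0) − K) e^{−ct}`. -/
theorem sub_eq_mul_exp {φ : ℝ → ℝ} {T c K : ℝ}
    (hφ : ∀ t ∈ Icc 0 T, HasDerivWithinAt φ (c * (K - φ t)) (Icc 0 T) t) {t : ℝ} (ht : t ∈ Icc 0 T) :
    φ t - K = (φ 0 - K) * exp (-(c * t)) :=
  le_antisymm (sub_le_mul_exp hφ (fun _ _ => le_rfl) ht) (mul_exp_le_sub hφ (fun _ _ => le_rfl) ht)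

end AggregateFrequency

/-! ## §1 Droop microgrid, FULL model: the droop-weighted mean frequency is EXACT first order -/

namespace DroopMicrogrid

variable {n : ℕ} (mg : DroopMicrogrid n)

/-- The droop-weighted frequency sum `S(ω) = Σ_i ω_i / λ^p_i` («dividing (8b) by `k_Pi` and summing over
all the nodes» [cite: ShinZavala2020, §III-A before (9)]). -/
def droopSum (ω : Fin n → ℝ) : ℝ := ∑ i, ω i / mg.kP i

/-- The synchronised frequency (deviation) of the lossless droop microgrid MODEL,
`ω_s = Σ_i P_i^set / Σ_i (1/λ^p_i)` (`InverterNetwork.syncFrequency_eq`; PROVENANCE P-INV-4 on the printed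
sign). [cite: ShinZavala2020, §III-A before (9)] [cite: SimpsonporcoDorflerBullo2013, Thm. 2] -/
def syncFreq : ℝ := (∑ i, mg.Pset i) / ∑ i, 1 / mg.kP i

/-- The droop-weighted mean frequency `ω̄(ω) = (Σ_i ω_i/λ^p_i) / Σ_i (1/λ^p_i)`. -/
def meanFreq (ω : Fin n → ℝ) : ℝ := mg.droopSum ω / ∑ i, 1 / mg.kP i

/-- Equation (4b) divided by `λ^p_i`, with a common filter constant `τ`:
`ω̇_i/λ^p_i = (−ω_i/λ^p_i + P_i^set − P_i(θ, V))/τ`, summed over the nodes: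
`Σ_i ω̇_i/λ^p_i = (Σ P_i^set − Σ P_i(θ, V) − S(ω))/τ`. -/
theorem sum_dω_div_kP (hk : ∀ i, mg.kP i ≠ 0) {τ : ℝ} (hτ : ∀ i, mg.τP i = τ) (x : State n) :
    ∑ i, mg.dω x i / mg.kP i
      = (∑ i, mg.Pset i - ∑ i, mg.P x.1 x.2.2 i - mg.droopSum x.2.1) / τ := by
  have hi : ∀ i, mg.dω x i / mg.kP i = (mg.Pset i - mg.P x.1 x.2.2 i - x.2.1 i / mg.kP i) / τ := by
    intro i
    have hk' := hk i
    simp only [dω, hτ i]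
    rw [div_div, mul_comm τ (mg.kP i), ← div_div]
    congr 1
    field_simp
    ring
  simp only [hi, droopSum, ← Finset.sum_div, Finset.sum_sub_distrib]

variable {mg}

/-- Along every solution of the FULL model the droop sum is differentiable within the time set with
derivative `(Σ P_i^set − Σ P_i(θ, V) − S)/τ` (common filter constant `τ`). -/
theorem hasDerivWithinAt_droopSum (hk : ∀ i, mg.kP i ≠ 0) {τ : ℝ} (hτ : ∀ i, mg.τP i = τ)
    {γ : ℝ → State n} {s : Set ℝ} (h : mg.IsSolutionOn γ s) {t : ℝ} (ht : t ∈ s) :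
    HasDerivWithinAt (fun r => mg.droopSum (γ r).2.1)
      ((∑ i, mg.Pset i - ∑ i, mg.P (γ t).1 (γ t).2.2 i - mg.droopSum (γ t).2.1) / τ) s t := by
  have hS := HasDerivWithinAt.fun_sum (u := univ)
    (fun i _ => (hasDerivWithinAt_freq h ht i).div_const (mg.kP i))
  rw [mg.sum_dω_div_kP hk hτ] at hS
  exact hS

/-- **Exact aggregate frequency law (FULL droop+QV model, every `n`).** Lossless reduced network
(`G = 0`, `B` symmetric), common filter constant `τ ≠ 0`, nonzero droop gains: along every solution of
(4a)–(4c) on `[0, T]`, `S(ω(t)) − Σ P_i^set = (S(ω(0)) − Σ P_i^set) e^{−t/τ}` for every `t ∈ [0, T]` —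
angles and voltages arbitrary. MODELLED: KunduEtAl2019 (4a)–(4c), bus-admittance form (MV-6N/V0). -/
theorem droopSum_sub_eq (hk : ∀ i, mg.kP i ≠ 0) {τ : ℝ} (hτ : ∀ i, mg.τP i = τ)
    (hG : ∀ i j, mg.G i j = 0) (hB : ∀ i j, mg.B i j = mg.B j i)
    {T : ℝ} {γ : ℝ → State n} (h : mg.IsSolutionOn γ (Icc 0 T)) {t : ℝ} (ht : t ∈ Icc 0 T) :
    mg.droopSum (γ t).2.1 - ∑ i, mg.Pset i
      = (mg.droopSum (γ 0).2.1 - ∑ i, mg.Pset i) * exp (-(t / τ)) := by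
  have hmain := AggregateFrequency.sub_eq_mul_exp (φ := fun r => mg.droopSum (γ r).2.1)
    (c := τ⁻¹) (K := ∑ i, mg.Pset i) (T := T) (fun s hs => ?_) ht
  · have e : τ⁻¹ * t = t / τ := by rw [div_eq_inv_mul]
    rw [e] at hmain
    exact hmain
  · refine (hasDerivWithinAt_droopSum hk hτ h hs).congr_deriv ?_
    rw [mg.sum_P_eq_zero_of_lossless hG hB, sub_zero, div_eq_inv_mul]

/-- **Mean-frequency form.** Same hypotheses and `Σ_i 1/λ^p_i ≠ 0`: `ω̄(t) − ω_s = (ω̄(0) − ω_s) e^{−t/τ}`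
on `[0, T]` — the droop-weighted mean frequency relaxes EXACTLY at the filter rate to the synchronised
frequency `ω_s` of the model, from any state, whether or not the angles synchronise. -/
theorem meanFreq_sub_syncFreq_eq (hk : ∀ i, mg.kP i ≠ 0) {τ : ℝ} (hτ : ∀ i, mg.τP i = τ)
    (hG : ∀ i j, mg.G i j = 0) (hB : ∀ i j, mg.B i j = mg.B j i)
    {T : ℝ} {γ : ℝ → State n} (h : mg.IsSolutionOn γ (Icc 0 T)) {t : ℝ} (ht : t ∈ Icc 0 T) :
    mg.meanFreq (γ t).2.1 - mg.syncFreq = (mg.meanFreq (γ 0).2.1 - mg.syncFreq) * exp (-(t / τ)) := by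
  have hmain := droopSum_sub_eq hk hτ hG hB h ht
  unfold meanFreq syncFreq
  rw [div_sub_div_same, div_sub_div_same, hmain, mul_div_right_comm]

/-- Restriction of a solution on `[0, ∞)` to `[0, T]`. -/
theorem isSolutionOn_Icc_of_Ici {γ : ℝ → State n} (h : mg.IsSolutionOn γ (Ici 0)) (T : ℝ) :
    mg.IsSolutionOn γ (Icc 0 T) :=
  fun t ht => (h t (mem_Ici.2 ht.1)).mono Icc_subset_Ici_self

/-- **The mean frequency converges to `ω_s` (FULL model, `τ > 0`).** Along every solution on `[0, ∞)`:
`ω̄(ω(t)) → ω_s` as `t → ∞` (angles and voltages arbitrary; an aggregate statement, NOT synchronisation). -/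
theorem meanFreq_tendsto_syncFreq (hk : ∀ i, mg.kP i ≠ 0) {τ : ℝ} (hτ : ∀ i, mg.τP i = τ)
    (hτpos : 0 < τ) (hG : ∀ i j, mg.G i j = 0) (hB : ∀ i j, mg.B i j = mg.B j i)
    {γ : ℝ → State n} (h : mg.IsSolutionOn γ (Ici 0)) :
    Tendsto (fun t => mg.meanFreq (γ t).2.1) atTop (𝓝 mg.syncFreq) := by
  have heq : ∀ t, 0 ≤ t → mg.meanFreq (γ t).2.1
      = mg.syncFreq + (mg.meanFreq (γ 0).2.1 - mg.syncFreq) * exp (-(t / τ)) := by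
    intro t ht
    have := meanFreq_sub_syncFreq_eq hk hτ hG hB (isSolutionOn_Icc_of_Ici h t) ⟨ht, le_rfl⟩
    linarith
  have hexp : Tendsto (fun t : ℝ => exp (-(t / τ))) atTop (𝓝 0) :=
    tendsto_exp_neg_atTop_nhds_zero.comp (tendsto_id.atTop_div_const hτpos)
  have hlim : Tendsto (fun t => mg.syncFreq + (mg.meanFreq (γ 0).2.1 - mg.syncFreq) * exp (-(t / τ)))
      atTop (𝓝 mg.syncFreq) := by
    simpa using tendsto_const_nhds.add (hexp.const_mul (mg.meanFreq (γ 0).2.1 - mg.syncFreq))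
  refine hlim.congr' ?_
  filter_upwards [eventually_ge_atTop 0] with t ht
  exact (heq t ht).symm

end DroopMicrogrid

/-! ## §2 Classical model with uniform damping: COI momentum — exact law (lossless), funnel (lossy) -/

namespace ClassicalSwing

variable {n : ℕ} (p : ClassicalSwing n)

/-- COI momentum `p(ω) = Σ_i M_i ω_i = M_T ω_COI` [cite: SauerPai1998, (6.243)–(6.244), (9.19)]. -/
def coiMomentum (ω : Fin n → ℝ) : ℝ := ∑ i, p.M i * ω i

/-- COI speed (deviation) `ω_COI = (1/M_T) Σ_i M_i ω_i` [cite: SauerPai1998, (6.243)]. -/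
def coiSpeed (ω : Fin n → ℝ) : ℝ := p.coiMomentum ω / ∑ i, p.M i

/-- COI accelerating power `P_COI(δ) = Σ_i (P_i − P_ei(δ))` [cite: SauerPai1998, (9.20)]. -/
def Pcoi (δ : Fin n → ℝ) : ℝ := ∑ i, (p.P i - p.Pe δ i)

/-- Net injected power `Σ_i P′_i`, `P′_i = P_i − E_i² G_ii` [cite: SauerPai1998, (9.20): `P_i = P_mi − E_i²G_ii`]. -/
def Pprime : ℝ := ∑ i, (p.P i - p.E i ^ 2 * p.G i i)

/-- Transfer-conductance bound `Γ = Σ_{i≠j} |D_ij|` (zero when `IsLossless`) [cite: SauerPai1998, (7.214)]. -/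
def transferBound : ℝ := ∑ i, ∑ j ∈ univ.erase i, |p.Dcoef i j|

/-- `Γ ≥ 0`. -/
theorem transferBound_nonneg : 0 ≤ p.transferBound := by unfold transferBound; positivity

/-- The synchronising terms cancel in the sum: `Σ_i Σ_{j≠i} C_ij sin(δ_i − δ_j) = 0` for symmetric `B`. -/
theorem sum_sum_Ccoef_sin_eq_zero (hB : ∀ i j, p.B i j = p.B j i) (δ : Fin n → ℝ) :
    ∑ i, ∑ j ∈ univ.erase i, p.Ccoef i j * sin (δ i - δ j) = 0 := by
  have h1 : ∀ i, ∑ j ∈ univ.erase i, p.Ccoef i j * sin (δ i - δ j)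
      = ∑ j, p.Ccoef i j * sin (δ i - δ j) := fun i => by
    rw [Finset.sum_erase_eq_sub (mem_univ i)]; simp
  have h : ∑ i, ∑ j, p.Ccoef i j * sin (δ i - δ j) = -∑ i, ∑ j, p.Ccoef i j * sin (δ i - δ j) := by
    conv_lhs => rw [Finset.sum_comm]
    rw [← Finset.sum_neg_distrib]
    refine Finset.sum_congr rfl fun i _ => ?_
    rw [← Finset.sum_neg_distrib]
    refine Finset.sum_congr rfl fun j _ => ?_
    have hC : p.Ccoef j i = p.Ccoef i j := by unfold Ccoef; rw [hB j i]; ring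
    rw [hC, ← neg_sub (δ i) (δ j), sin_neg]
    ring
  simp only [h1]
  linarith

/-- `P_COI(δ) = Σ_i P′_i − Σ_{i≠j} D_ij cos(δ_i − δ_j)` for symmetric `B` [cite: SauerPai1998, (9.20)]. -/
theorem Pcoi_eq (hB : ∀ i j, p.B i j = p.B j i) (δ : Fin n → ℝ) :
    p.Pcoi δ = p.Pprime - ∑ i, ∑ j ∈ univ.erase i, p.Dcoef i j * cos (δ i - δ j) := by
  have hi : ∀ i, p.P i - p.Pe δ i = (p.P i - p.E i ^ 2 * p.G i i)
      - ∑ j ∈ univ.erase i, p.Ccoef i j * sin (δ i - δ j)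
      - ∑ j ∈ univ.erase i, p.Dcoef i j * cos (δ i - δ j) := by
    intro i; unfold Pe; rw [Finset.sum_add_distrib]; ring
  unfold Pcoi Pprime
  simp only [hi, Finset.sum_sub_distrib, p.sum_sum_Ccoef_sin_eq_zero hB δ, sub_zero]

/-- No transfer conductances ⇒ `P_COI ≡ Σ_i P′_i` (constant). -/
theorem Pcoi_eq_of_lossless (hB : ∀ i j, p.B i j = p.B j i) (hL : p.IsLossless) (δ : Fin n → ℝ) :
    p.Pcoi δ = p.Pprime := by
  rw [p.Pcoi_eq hB]
  have : ∀ i, ∑ j ∈ univ.erase i, p.Dcoef i j * cos (δ i - δ j) = 0 := fun i =>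
    Finset.sum_eq_zero fun j hj => by
      rw [Dcoef, hL i j (Finset.ne_of_mem_erase hj).symm]; ring
  simp [this]

/-- `|P_COI(δ) − Σ_i P′_i| ≤ Γ` at every angle configuration. -/
theorem abs_Pcoi_sub_Pprime_le (hB : ∀ i j, p.B i j = p.B j i) (δ : Fin n → ℝ) :
    |p.Pcoi δ - p.Pprime| ≤ p.transferBound := by
  rw [p.Pcoi_eq hB]
  have e : p.Pprime - ∑ i, ∑ j ∈ univ.erase i, p.Dcoef i j * cos (δ i - δ j) - p.Pprime
      = -∑ i, ∑ j ∈ univ.erase i, p.Dcoef i j * cos (δ i - δ j) := by ring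
  rw [e, abs_neg]
  unfold transferBound
  refine (abs_sum_le_sum_abs _ _).trans (sum_le_sum fun i _ =>
    (abs_sum_le_sum_abs _ _).trans (sum_le_sum fun j _ => ?_))
  rw [abs_mul]
  exact mul_le_of_le_one_right (abs_nonneg _) (abs_cos_le_one _)

/-- Uniform damping `D_i = d M_i` ⇒ `Σ_i D_i ω_i = d · p(ω)`. -/
theorem sum_D_mul_eq_of_uniform {d : ℝ} (hD : ∀ i, p.D i = d * p.M i) (ω : Fin n → ℝ) :
    ∑ i, p.D i * ω i = d * p.coiMomentum ω := by
  unfold coiMomentum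
  rw [Finset.mul_sum]
  exact Finset.sum_congr rfl fun i _ => by rw [hD i]; ring

variable {p}

/-- Along every solution of `M_cl` (nonzero inertias) the COI momentum has derivative
`P_COI(δ) − Σ_i D_i ω_i` within the time set (sum of (7.216) over the machines). -/
theorem hasDerivWithinAt_coiMomentum (hM : ∀ i, p.M i ≠ 0) {γ : ℝ → State n} {s : Set ℝ}
    (h : p.IsSolutionOn γ s) {t : ℝ} (ht : t ∈ s) :
    HasDerivWithinAt (fun r => p.coiMomentum (γ r).2)
      (p.Pcoi (γ t).1 - ∑ i, p.D i * (γ t).2 i) s t := by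
  have hS := HasDerivWithinAt.fun_sum (u := univ)
    (fun i _ => (hasDerivWithinAt_speed h ht i).const_mul (p.M i))
  refine hS.congr_deriv ?_
  unfold Pcoi
  rw [← Finset.sum_sub_distrib]
  exact Finset.sum_congr rfl fun i _ => by field_simp [hM i]

/-- **Exact COI law (uniform damping, no transfer conductances).** `M_i ≠ 0`, `B` symmetric, `IsLossless`,
`D_i = d M_i` with `d ≠ 0`: along every solution on `[0, T]`,
`p(t) − Σ P′_i/d = (p(0) − Σ P′_i/d) e^{−dt}` for every `t ∈ [0, T]` (`p = M_T ω_COI`). MODELLED: `M_cl`. -/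
theorem coiMomentum_sub_eq_of_lossless (hM : ∀ i, p.M i ≠ 0) (hB : ∀ i j, p.B i j = p.B j i)
    (hL : p.IsLossless) {d : ℝ} (hD : ∀ i, p.D i = d * p.M i) (hd : d ≠ 0)
    {T : ℝ} {γ : ℝ → State n} (h : p.IsSolutionOn γ (Icc 0 T)) {t : ℝ} (ht : t ∈ Icc 0 T) :
    p.coiMomentum (γ t).2 - p.Pprime / d = (p.coiMomentum (γ 0).2 - p.Pprime / d) * exp (-(d * t)) := by
  refine AggregateFrequency.sub_eq_mul_exp (φ := fun r => p.coiMomentum (γ r).2) (c := d)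
    (K := p.Pprime / d) (T := T) (fun s hs => ?_) ht
  have hs' := hasDerivWithinAt_coiMomentum hM h hs
  rw [p.Pcoi_eq_of_lossless hB hL, p.sum_D_mul_eq_of_uniform hD] at hs'
  refine hs'.congr_deriv ?_
  field_simp

/-- Restriction of a solution on `[0, ∞)` to `[0, T]`. -/
theorem isSolutionOn_Icc_of_Ici {γ : ℝ → State n} (h : p.IsSolutionOn γ (Ici 0)) (T : ℝ) :
    p.IsSolutionOn γ (Icc 0 T) :=
  fun t ht => (h t (mem_Ici.2 ht.1)).mono Icc_subset_Ici_self

/-- **COI speed converges (uniform damping `d > 0`, no transfer conductances, `M_T ≠ 0`).** Along every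
solution on `[0, ∞)`: `ω_COI(t) → Σ_i P′_i / (d M_T)`; in particular `ω_COI(t) → 0` when the dispatch is
balanced (`Σ P′_i = 0`, e.g. `P′ = P_e(δ^s)` at an equilibrium of the lossless model). Aggregate only. -/
theorem coiSpeed_tendsto_of_lossless (hM : ∀ i, p.M i ≠ 0) (hB : ∀ i j, p.B i j = p.B j i)
    (hL : p.IsLossless) {d : ℝ} (hD : ∀ i, p.D i = d * p.M i) (hd : 0 < d)
    {γ : ℝ → State n} (h : p.IsSolutionOn γ (Ici 0)) :
    Tendsto (fun t => p.coiSpeed (γ t).2) atTop (𝓝 (p.Pprime / (d * ∑ i, p.M i))) := by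
  set L := p.Pprime / (d * ∑ i, p.M i) with hL'
  have heq : ∀ t, 0 ≤ t → p.coiSpeed (γ t).2 = L + (p.coiSpeed (γ 0).2 - L) * exp (-(d * t)) := by
    intro t ht
    have e := coiMomentum_sub_eq_of_lossless hM hB hL hD hd.ne' (isSolutionOn_Icc_of_Ici h t)
      ⟨ht, le_rfl⟩
    have hLM : L = p.Pprime / d / ∑ i, p.M i := by rw [hL', div_div]
    have e2 : p.coiSpeed (γ t).2 - L = (p.coiSpeed (γ 0).2 - L) * exp (-(d * t)) := by
      unfold coiSpeed
      rw [hLM, div_sub_div_same, div_sub_div_same, e, mul_div_right_comm]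
    linarith
  have hexp : Tendsto (fun t : ℝ => exp (-(d * t))) atTop (𝓝 0) :=
    tendsto_exp_neg_atTop_nhds_zero.comp (tendsto_id.const_mul_atTop hd)
  have hlim : Tendsto (fun t => L + (p.coiSpeed (γ 0).2 - L) * exp (-(d * t))) atTop (𝓝 L) := by
    simpa using tendsto_const_nhds.add (hexp.const_mul (p.coiSpeed (γ 0).2 - L))
  refine hlim.congr' ?_
  filter_upwards [eventually_ge_atTop 0] with t ht
  exact (heq t ht).symm

/-- **COI funnel WITH transfer conductances (uniform damping).** `M_i ≠ 0`, `B` symmetric, `D_i = d M_i`,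
`d ≠ 0`: along every solution on `[0, T]`, for every `t ∈ [0, T]`,
`p(t) − (Σ P′_i + Γ)/d ≤ (p(0) − (Σ P′_i + Γ)/d) e^{−dt}` and
`(p(0) − (Σ P′_i − Γ)/d) e^{−dt} ≤ p(t) − (Σ P′_i − Γ)/d`. -/
theorem coiMomentum_funnel (hM : ∀ i, p.M i ≠ 0) (hB : ∀ i j, p.B i j = p.B j i)
    {d : ℝ} (hD : ∀ i, p.D i = d * p.M i) (hd : d ≠ 0)
    {T : ℝ} {γ : ℝ → State n} (h : p.IsSolutionOn γ (Icc 0 T)) {t : ℝ} (ht : t ∈ Icc 0 T) :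
    p.coiMomentum (γ t).2 - (p.Pprime + p.transferBound) / d
        ≤ (p.coiMomentum (γ 0).2 - (p.Pprime + p.transferBound) / d) * exp (-(d * t)) ∧
      (p.coiMomentum (γ 0).2 - (p.Pprime - p.transferBound) / d) * exp (-(d * t))
        ≤ p.coiMomentum (γ t).2 - (p.Pprime - p.transferBound) / d := by
  have hder := fun s (hs : s ∈ Icc 0 T) => hasDerivWithinAt_coiMomentum hM h hs
  have hb := fun s (hs : s ∈ Icc 0 T) => abs_le.mp (p.abs_Pcoi_sub_Pprime_le hB (γ s).1)
  constructor
  · refine AggregateFrequency.sub_le_mul_exp (c := d) (K := (p.Pprime + p.transferBound) / d)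
      hder (fun s hs => ?_) ht
    rw [p.sum_D_mul_eq_of_uniform hD]
    have e : d * ((p.Pprime + p.transferBound) / d - p.coiMomentum (γ s).2)
        = p.Pprime + p.transferBound - d * p.coiMomentum (γ s).2 := by
      rw [mul_sub, mul_div_cancel₀ _ hd]
    rw [e]
    linarith [(hb s hs).2]
  · refine AggregateFrequency.mul_exp_le_sub (c := d) (K := (p.Pprime - p.transferBound) / d)
      hder (fun s hs => ?_) ht
    rw [p.sum_D_mul_eq_of_uniform hD]
    have e : d * ((p.Pprime - p.transferBound) / d - p.coiMomentum (γ s).2)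
        = p.Pprime - p.transferBound - d * p.coiMomentum (γ s).2 := by
      rw [mul_sub, mul_div_cancel₀ _ hd]
    rw [e]
    linarith [(hb s hs).1]

/-- **COI funnel, absolute form (`d > 0`).** `|p(t) − Σ P′_i/d| ≤ Γ/d + |p(0) − Σ P′_i/d| e^{−dt}` on
`[0, T]`: the COI momentum enters and stays in the band of half-width `Γ/d` (set by the transfer
conductances alone) around `Σ P′_i/d`, exponentially at the uniform damping rate, from ANY state. -/
theorem abs_coiMomentum_sub_le (hM : ∀ i, p.M i ≠ 0) (hB : ∀ i j, p.B i j = p.B j i)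
    {d : ℝ} (hD : ∀ i, p.D i = d * p.M i) (hd : 0 < d)
    {T : ℝ} {γ : ℝ → State n} (h : p.IsSolutionOn γ (Icc 0 T)) {t : ℝ} (ht : t ∈ Icc 0 T) :
    |p.coiMomentum (γ t).2 - p.Pprime / d|
      ≤ p.transferBound / d + |p.coiMomentum (γ 0).2 - p.Pprime / d| * exp (-(d * t)) := by
  obtain ⟨hu, hl⟩ := coiMomentum_funnel hM hB hD hd.ne' h ht
  have hΓ : 0 ≤ p.transferBound / d := div_nonneg p.transferBound_nonneg hd.le
  have he : 0 < exp (-(d * t)) := exp_pos _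
  have h0a := le_abs_self (p.coiMomentum (γ 0).2 - p.Pprime / d)
  have h0b := neg_abs_le (p.coiMomentum (γ 0).2 - p.Pprime / d)
  have e1 : (p.Pprime + p.transferBound) / d = p.Pprime / d + p.transferBound / d := add_div _ _ _
  have e2 : (p.Pprime - p.transferBound) / d = p.Pprime / d - p.transferBound / d := sub_div _ _ _
  rw [e1] at hu; rw [e2] at hl
  rw [abs_le]
  constructor <;> nlinarith

end ClassicalSwing

end Summit.Ventures.GridStability.Models

end
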